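import Literature.Barriers.NavierStokesRegularity.NavierStokesInequalityCantorArrangement
import HarnessLib

/-!
# The one-point arrangement is a corollary of the Cantor arrangement (Ożański 2017, §6.2)

Barrier catalogue support file for `NavierStokesRegularity` (D-0021), a bridge between the two
decompositions of Scheffer's constructions: fact C `NSIArrangementExists` of
`NavierStokesInequalityArrangement` (the geometric arrangement for the one-point blow-up,
W. S. Ożański, arXiv:1709.00602v4, §5) and fact C′ `NSICantorArrangementExists` of
`NavierStokesInequalityCantorArrangement` (the geometric arrangement for the Cantor-set blow-up,
§6.5). Ożański, §6.2, p. 28: "In fact, the previous geometric arrangement is recovered if one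
takes `ξ = 0`, `M = 1`." In the tree this is `IsNSICantorArrangement.isNSIArrangement` (forget
all similarities but `Γ_1(x) = τx + z`); here it is lifted to the named facts:
**`NSICantorArrangementExists → NSIArrangementExists`** (`nsiArrangementExists_of_cantor`, take
`ξ = 1/2`). Consequence for the discharge of both facts: §5 of Ożański (copies of `U`, the sum
`H`, Lemmas 5.2–5.3, §§5.4–5.5) need only be formalised ONCE, in the `M`-copy generality of
§6.5 (Steps 1–6, Lemma 18); the one-point fact then follows from the Cantor fact by this
theorem. Nothing new is asserted; no definitions.

## References

* W. S. Ożański, *On weak solutions to the Navier–Stokes inequality with internal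
  singularities*, arXiv:1709.00602v4 (2017/2019), §6.2 (p. 28) and §6.5 (opening paragraph:
  "The construction builds on the objects defined previously (in Section 5) and, remarkably,
  can be obtained simply by taking `ε > 0` … smaller"). [`Ozanski2017NSISingular`]
* V. Scheffer, Comm. Math. Phys. 110 (1987), 525–551, §4; Comm. Math. Phys. 101 (1985), 47–85,
  §4. [`Scheffer1987`, `Scheffer1985`]
-/

noncomputable section

namespace Literature.Barriers.NavierStokesRegularity

/-- **The one-point arrangement from the Cantor arrangement** (Ożański 2017, §6.2, p. 28:
"the previous geometric arrangement is recovered if one takes `ξ = 0`, `M = 1`"; here: take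
`ξ = 1/2` in fact C′ and keep only the first similarity, `IsNSICantorArrangement.isNSIArrangement`).
Hence a proof of `NSICantorArrangementExists` (§6.5) discharges `NSIArrangementExists` (§5).
[cite: Ozanski2017NSISingular, §6.2 p. 28] -/
theorem nsiArrangementExists_of_cantor (hC : NSICantorArrangementExists) :
    NSIArrangementExists := by
  obtain ⟨U₁, U₂, v₁, f₁, φ₁, v₂, f₂, φ₂, T, τ, M, X, z, -, h⟩ :=
    hC (1 / 2) one_half_pos one_half_lt_one
  exact ⟨U₁, U₂, v₁, f₁, φ₁, v₂, f₂, φ₂, T, τ, z, h.isNSIArrangement⟩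

/-- The same bridge at the level of the reductions already in the tree: facts C′ and D
(`NSIBlock_of_arrangement`, Ożański §4) give the one-point block `NSIBlockExists`
(`nsiBlockExists_of_arrangement`). [cite: Ozanski2017NSISingular, §4 (opening) and §6.2 p. 28] -/
theorem nsiBlockExists_of_cantorArrangement (hC : NSICantorArrangementExists)
    (hD : NSIBlock_of_arrangement) : NSIBlockExists :=
  nsiBlockExists_of_arrangement (nsiArrangementExists_of_cantor hC) hD

end Literature.Barriers.NavierStokesRegularity

end
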